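import Literature.NumberTheory.Automorphic.UnitaryGroupBorelLatticeCellCountSiegel
import Literature.NumberTheory.Automorphic.UnitaryGroupBorelSiegelSetStructureTwo
import Literature.NumberTheory.Automorphic.UnitaryGroupKernelBorelClassHomogeneityTwo
import HarnessLib

/-!
# The `O(δ_B)` count of rational Borel elements on a Siegel set of `U(J₂)` (H-side sibling of brick H4-d at `N = 2`)
(Rogawski, *Automorphic Representations of Unitary Groups in Three Variables* (1990), §2.2, p. 13; Arthur, *A trace formula for
reductive groups I*, Duke Math. J. 45 (1978), §5: on a Siegel set the number of `β ∈ B(F)` with `g⁻¹ β g` in a compact set is `O(δ_B)`)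

Topic `NumberTheory/Automorphic`; namespace `Literature.NumberTheory.Automorphic.UnitaryGroup`.  THEOREMS ONLY (no definition, no
named fact, no instance, no notation, no `sorry`).  ★ `UnitaryGroupBorelLatticeCellCount` §1 (the cell count along `B(F) = T(F) N(F)`)
and ★ `UnitaryGroupBorelLatticeCellCountSiegel` §4 (finitely many torus fibres) are typed at general `N`; their `N = 3` paragraphs
(the `δ_B`-scaling of `N(𝔸_F)` under `B(𝔸_F)`-conjugation in the Heisenberg chart, the torus contraction, the count) get here their
`N = 2` siblings on the LINE `N(𝔸_F) ≅ 𝔸_E⁻` over ★ H-B1a∕b (`UnitaryGroupLineUnipotentTwo`, `UnitaryGroupBorelModulusTwo`: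
`(u ↦ t⁻¹ u t)_* ν = δ_B(t) • ν`, `N(𝔸_F)` abelian hence unimodular) and ★ (R2) `UnitaryGroupBorelSiegelSetStructureTwo` (torus
contraction on the line).  H-side copy of LAWS 1–5 of the T1 engine `Cruxes/H413/Lines/F0_T1InnerFormTraceIdentity.lean` (cell
`pub/hodgecm-mathlib`, crux H413; census `CENSUS-LAWS-Hside.F0P3a-p03g6.md` §3 LAW 1; B-p14 (g26) NEXT-3 (R3)).  HC_CM is proved only modulo
the printed citations until rung 0 closes.

* §1 `measure_preimage_borelConj_two` — `ν {u : b⁻¹ u b ∈ X} = δ_B(b) · ν(X)` for EVERY set `X` and every `b ∈ B(𝔸_F)` (★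
  `map_borelConj_eq_torusRootModulus_smul_two` of ★ `UnitaryGroupKernelBorelClassHomogeneityTwo`, through the measurable automorphism).
* §2 **`measure_cellSet_borel_mul_le_two`** — the `x = b k` step `ν(A_t(b k, C) · W) ≤ δ_B(b) · ν(A_t(k, C) · b⁻¹ W b)`.
* §3 **`exists_isCompact_borelConj_image_subset_two`** — `b⁻¹ W b` stays in one compact set when the unipotent part of `b` and its root
  value lie in compacta (★ (R2) `exists_isCompact_torusConj_mem_two`).
* §4 **`exists_forall_card_mul_measure_le_mul_torusRootModulus_two`** — THE COUNT `#R · ν(𝓕) ≤ C₀ · δ_B(b)` on the Siegel set, with the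
  structure hypotheses «`(torusPart b)⁻¹ b ∈ Ω`, `d₀⁻¹ d₁ ∈ R₁`» of ★ (R2) `exists_isCompact_structure_of_mem_siegel_two`.

## References
* J. D. Rogawski, *Automorphic Representations of Unitary Groups in Three Variables*, Ann. of Math. Stud. 123 (1990), §2.2 (p. 13) [Rogawski1990].
* A. Weil, *Basic Number Theory* (1967/1974), Chap. I [Weil1965].
* J. Arthur, *A trace formula for reductive groups I*, Duke Math. J. 45 (1978), §5 [Arthur1978TraceFormulaI].
-/

set_option autoImplicit false

noncomputable section

open MeasureTheory NumberField IsDedekindDomain Topology Set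
open scoped NNReal ENNReal MatrixGroups Pointwise

namespace Literature.NumberTheory.Automorphic

namespace UnitaryGroup

variable {F E : Type} [Field F] [NumberField F] [Field E] [NumberField E] [Algebra F E] {c : E ≃ₐ[F] E}

/-- The preimage in `N(𝔸_F)` of a compact set of `G(𝔸_F)` is compact (`N(𝔸_F)` is closed; plumbing, any `N`). [folklore] -/
private theorem isCompact_preimage_coe_adelicUnipotent₂ {N : ℕ} {K : Set (quasiSplit F E c N).Adelic} (hK : IsCompact K) :
    IsCompact ((fun m : adelicUnipotent F E c N => (m : (quasiSplit F E c N).Adelic)) ⁻¹' K) := by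
  haveI : T2Space (FiniteAdeleRing (𝓞 E) E) := inferInstanceAs <| T2Space
    (RestrictedProduct (fun w : HeightOneSpectrum (𝓞 E) => w.adicCompletion E)
      (fun w => (w.adicCompletionIntegers E : Set (w.adicCompletion E))) Filter.cofinite)
  haveI : T2Space (InfiniteAdeleRing E) :=
    inferInstanceAs <| T2Space ((w : InfinitePlace E) → w.Completion)
  haveI : T2Space (AdeleRing (𝓞 E) E) := inferInstanceAs <| T2Space (InfiniteAdeleRing E × FiniteAdeleRing (𝓞 E) E)
  have hcl : IsClosed ((adelicUnipotent F E c N : Set (quasiSplit F E c N).Adelic)) := by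
    change IsClosed (⇑(adelicVal F E c N ((StdForm.antidiagonal N).over E)) ⁻¹'
      ((upperUnitriangular (Fin N) (AdeleRing (𝓞 E) E) : Subgroup (GL (Fin N) (AdeleRing (𝓞 E) E))) :
        Set (GL (Fin N) (AdeleRing (𝓞 E) E))))
    exact (isClosed_upperUnitriangular (R := AdeleRing (𝓞 E) E)).preimage continuous_subtype_val
  exact hcl.isClosedEmbedding_subtypeVal.isCompact_preimage hK

section Two

variable [LocallyCompactSpace (AdeleRing (𝓞 E) E)] [MeasurableSpace (AdeleRing (𝓞 E) E)] [BorelSpace (AdeleRing (𝓞 E) E)]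
  [MeasurableSpace (adelicUnipotent F E c 2)] [BorelSpace (adelicUnipotent F E c 2)]

/-! ## §1 `ν {u : b⁻¹ u b ∈ X} = δ_B(b) · ν(X)` on the line, for every `b ∈ B(𝔸_F)` -/


/-- **`ν {u : b⁻¹ u b ∈ X} = δ_B(b) · ν(X)` for EVERY set `X ⊆ N(𝔸_F)`**, every Haar measure `ν` of `N(𝔸_F) ≤ U(J₂)` and every
`b ∈ B(𝔸_F)` (★ `map_borelConj_eq_torusRootModulus_smul_two` through the measurable automorphism `u ↦ b⁻¹ u b`, Mathlib
`MeasurableEquiv.map_apply`). [cite: Rogawski1990, §2.2] -/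
theorem measure_preimage_borelConj_two (hc : c * c = 1) (hc1 : c ≠ 1)
    (ν : Measure (adelicUnipotent F E c 2)) [ν.IsHaarMeasure] (b : borelAdelic F E c 2)
    (X : Set (adelicUnipotent F E c 2)) :
    ν {u : adelicUnipotent F E c 2 |
        (⟨(b : (quasiSplit F E c 2).Adelic)⁻¹ * (u : (quasiSplit F E c 2).Adelic) * (b : (quasiSplit F E c 2).Adelic),
          conj_mem_adelicUnipotent b.2 u.2⟩ : adelicUnipotent F E c 2) ∈ X} =
      ((torusRootModulus E 2 (diagUnit b.2) : ℝ≥0) : ℝ≥0∞) * ν X := by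
  obtain ⟨α, hα⟩ := exists_continuousMulEquiv_adelicUnipotent_conj (N := 2) b.2
  have hfun : (fun u : adelicUnipotent F E c 2 =>
      (⟨(b : (quasiSplit F E c 2).Adelic)⁻¹ * (u : (quasiSplit F E c 2).Adelic) * (b : (quasiSplit F E c 2).Adelic),
        conj_mem_adelicUnipotent b.2 u.2⟩ : adelicUnipotent F E c 2)) = α :=
    funext fun u => Subtype.ext (hα u).symm
  set ψ : adelicUnipotent F E c 2 ≃ᵐ adelicUnipotent F E c 2 := α.toHomeomorph.toMeasurableEquiv with hψ
  have hψα : (ψ : adelicUnipotent F E c 2 → adelicUnipotent F E c 2) = α := rfl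
  have hmap := map_borelConj_eq_torusRootModulus_smul_two hc hc1 ν b
  rw [hfun, ← hψα] at hmap
  have happ := MeasurableEquiv.map_apply ψ (μ := ν) X
  rw [hmap, Measure.smul_apply, smul_eq_mul] at happ
  have hset : {u : adelicUnipotent F E c 2 |
      (⟨(b : (quasiSplit F E c 2).Adelic)⁻¹ * (u : (quasiSplit F E c 2).Adelic) * (b : (quasiSplit F E c 2).Adelic),
        conj_mem_adelicUnipotent b.2 u.2⟩ : adelicUnipotent F E c 2) ∈ X} =
      (ψ : adelicUnipotent F E c 2 → adelicUnipotent F E c 2) ⁻¹' X := by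
    rw [hψα, ← hfun]
    rfl
  rw [hset]
  exact happ.symm

/-! ## §2 The `δ_B`-factor of the count for `x = b k` -/

/-- **THE `δ_B`-FACTOR OF THE COUNT at `N = 2`.** For `b ∈ B(𝔸_F)`, `k ∈ G(𝔸_F)`, `C ⊆ G(𝔸_F)`, `W ⊆ N(𝔸_F)`, `t ∈ T(F)` and every
Haar measure `ν` of `N(𝔸_F)`, with `A_t(x) = {m : x⁻¹ t m x ∈ C}`: `ν(A_t(b k) · W) ≤ δ_B(b) · ν(A_t(k) · b⁻¹ W b)`, since
`b⁻¹ t m b = t [t, b] (b⁻¹ m b)` with `[t, b] ∈ N(𝔸_F)` (★ `torus_commutator_mem_adelicUnipotent`). [cite: Rogawski1990, §2.2 (p. 13)] -/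
theorem measure_cellSet_borel_mul_le_two (hc : c * c = 1) (hc1 : c ≠ 1)
    (ν : Measure (adelicUnipotent F E c 2)) [ν.IsHaarMeasure] (b : borelAdelic F E c 2)
    (k : (quasiSplit F E c 2).Adelic) (C : Set (quasiSplit F E c 2).Adelic)
    (W : Set (adelicUnipotent F E c 2)) (t : rationalTorus F E c 2) :
    ν ({m : adelicUnipotent F E c 2 | ((b : (quasiSplit F E c 2).Adelic) * k)⁻¹ *
          ((t : torusAdelic F E c 2) : (quasiSplit F E c 2).Adelic) *
          ((m : adelicUnipotent F E c 2) : (quasiSplit F E c 2).Adelic) * ((b : (quasiSplit F E c 2).Adelic) * k) ∈ C} * W) ≤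
      ((torusRootModulus E 2 (diagUnit b.2) : ℝ≥0) : ℝ≥0∞) *
        ν ({m : adelicUnipotent F E c 2 | k⁻¹ * ((t : torusAdelic F E c 2) : (quasiSplit F E c 2).Adelic) *
            ((m : adelicUnipotent F E c 2) : (quasiSplit F E c 2).Adelic) * k ∈ C} *
          ((fun w : adelicUnipotent F E c 2 =>
            (⟨(b : (quasiSplit F E c 2).Adelic)⁻¹ * (w : (quasiSplit F E c 2).Adelic) * (b : (quasiSplit F E c 2).Adelic),
              conj_mem_adelicUnipotent b.2 w.2⟩ : adelicUnipotent F E c 2)) '' W)) := by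
  obtain ⟨α, hα⟩ := exists_continuousMulEquiv_adelicUnipotent_conj (N := 2) b.2
  have hfun : (fun u : adelicUnipotent F E c 2 =>
      (⟨(b : (quasiSplit F E c 2).Adelic)⁻¹ * (u : (quasiSplit F E c 2).Adelic) * (b : (quasiSplit F E c 2).Adelic),
        conj_mem_adelicUnipotent b.2 u.2⟩ : adelicUnipotent F E c 2)) = α :=
    funext fun u => Subtype.ext (hα u).symm
  obtain ⟨cc, hcc⟩ : ∃ cc : adelicUnipotent F E c 2, (cc : (quasiSplit F E c 2).Adelic) =
      (((t : torusAdelic F E c 2) : (quasiSplit F E c 2).Adelic))⁻¹ * (b : (quasiSplit F E c 2).Adelic)⁻¹ *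
        ((t : torusAdelic F E c 2) : (quasiSplit F E c 2).Adelic) * (b : (quasiSplit F E c 2).Adelic) :=
    ⟨⟨_, torus_commutator_mem_adelicUnipotent (t : torusAdelic F E c 2).2 b⟩, rfl⟩
  have hscale : ∀ X : Set (adelicUnipotent F E c 2),
      ν {u : adelicUnipotent F E c 2 | α u ∈ X} = ((torusRootModulus E 2 (diagUnit b.2) : ℝ≥0) : ℝ≥0∞) * ν X := by
    intro X
    have h := measure_preimage_borelConj_two hc hc1 ν b X
    have hset : {u : adelicUnipotent F E c 2 |
        (⟨(b : (quasiSplit F E c 2).Adelic)⁻¹ * (u : (quasiSplit F E c 2).Adelic) * (b : (quasiSplit F E c 2).Adelic),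
          conj_mem_adelicUnipotent b.2 u.2⟩ : adelicUnipotent F E c 2) ∈ X} =
        {u : adelicUnipotent F E c 2 | α u ∈ X} :=
      Set.ext fun u => by rw [Set.mem_setOf_eq, Set.mem_setOf_eq, ← congrFun hfun u]
    rw [hset] at h
    exact h
  rw [hfun]
  have hsub : {m : adelicUnipotent F E c 2 | ((b : (quasiSplit F E c 2).Adelic) * k)⁻¹ *
        ((t : torusAdelic F E c 2) : (quasiSplit F E c 2).Adelic) *
        ((m : adelicUnipotent F E c 2) : (quasiSplit F E c 2).Adelic) * ((b : (quasiSplit F E c 2).Adelic) * k) ∈ C} * W ⊆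
      {u : adelicUnipotent F E c 2 | α u ∈ (fun v : adelicUnipotent F E c 2 => cc * v) ⁻¹'
        ({m : adelicUnipotent F E c 2 | k⁻¹ * ((t : torusAdelic F E c 2) : (quasiSplit F E c 2).Adelic) *
            ((m : adelicUnipotent F E c 2) : (quasiSplit F E c 2).Adelic) * k ∈ C} * (α '' W))} := by
    rintro _ ⟨m, hm, w, hw, rfl⟩
    rw [Set.mem_setOf_eq, Set.mem_preimage, map_mul, ← mul_assoc]
    refine Set.mul_mem_mul ?_ (Set.mem_image_of_mem _ hw)
    rw [Set.mem_setOf_eq, Subgroup.coe_mul, hcc, hα m]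
    rw [Set.mem_setOf_eq] at hm
    have hm' := hm
    simp only [mul_inv_rev, mul_assoc, mul_inv_cancel_left] at hm' ⊢
    exact hm'
  calc ν ({m : adelicUnipotent F E c 2 | ((b : (quasiSplit F E c 2).Adelic) * k)⁻¹ *
          ((t : torusAdelic F E c 2) : (quasiSplit F E c 2).Adelic) *
          ((m : adelicUnipotent F E c 2) : (quasiSplit F E c 2).Adelic) * ((b : (quasiSplit F E c 2).Adelic) * k) ∈ C} * W)
      ≤ ν {u : adelicUnipotent F E c 2 | α u ∈ (fun v : adelicUnipotent F E c 2 => cc * v) ⁻¹'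
          ({m : adelicUnipotent F E c 2 | k⁻¹ * ((t : torusAdelic F E c 2) : (quasiSplit F E c 2).Adelic) *
              ((m : adelicUnipotent F E c 2) : (quasiSplit F E c 2).Adelic) * k ∈ C} * (α '' W))} :=
        measure_mono hsub
    _ = ((torusRootModulus E 2 (diagUnit b.2) : ℝ≥0) : ℝ≥0∞) *
          ν ((fun v : adelicUnipotent F E c 2 => cc * v) ⁻¹'
            ({m : adelicUnipotent F E c 2 | k⁻¹ * ((t : torusAdelic F E c 2) : (quasiSplit F E c 2).Adelic) *
              ((m : adelicUnipotent F E c 2) : (quasiSplit F E c 2).Adelic) * k ∈ C} * (α '' W))) := hscale _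
    _ = ((torusRootModulus E 2 (diagUnit b.2) : ℝ≥0) : ℝ≥0∞) *
          ν ({m : adelicUnipotent F E c 2 | k⁻¹ * ((t : torusAdelic F E c 2) : (quasiSplit F E c 2).Adelic) *
              ((m : adelicUnipotent F E c 2) : (quasiSplit F E c 2).Adelic) * k ∈ C} * (α '' W)) := by
        rw [measure_preimage_mul]

end Two

/-! ## §3 Conjugation by `b ∈ B(𝔸_F)` with unipotent part in a compact and root value in a compact -/

/-- **`b⁻¹ W b` STAYS IN ONE COMPACT SET ON A SIEGEL SET OF `U(J₂)`.** For compact `W ⊆ N(𝔸_F)`, `Ω ⊆ G(𝔸_F)` and `R₁ ⊆ 𝔸_E` there is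
a compact `W' ⊆ N(𝔸_F)` with `b⁻¹ W b ⊆ W'` for every `b ∈ B(𝔸_F)` whose unipotent part `n₀ = (torusPart b)⁻¹ b` lies in `Ω` and whose
root value `d₀⁻¹ d₁` lies in `R₁`: `b⁻¹ w b = n₀⁻¹ (t⁻¹ w t) n₀`, `t = torusPart b` (★ (R2) `exists_isCompact_torusConj_mem_two`).
[cite: Rogawski1990, §2.2 (p. 13)] -/
theorem exists_isCompact_borelConj_image_subset_two {W : Set (adelicUnipotent F E c 2)}
    (hW : IsCompact W) {Ω : Set (quasiSplit F E c 2).Adelic} (hΩ : IsCompact Ω)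
    {R₁ : Set (AdeleRing (𝓞 E) E)} (hR₁ : IsCompact R₁) :
    ∃ W' : Set (adelicUnipotent F E c 2), IsCompact W' ∧
      ∀ b : borelAdelic F E c 2,
        (((torusPart b)⁻¹ * b : borelAdelic F E c 2) : (quasiSplit F E c 2).Adelic) ∈ Ω →
        (((diagUnit b.2 0)⁻¹ * diagUnit b.2 1 : (AdeleRing (𝓞 E) E)ˣ) : AdeleRing (𝓞 E) E) ∈ R₁ →
        (fun w : adelicUnipotent F E c 2 =>
          (⟨(b : (quasiSplit F E c 2).Adelic)⁻¹ * (w : (quasiSplit F E c 2).Adelic) * (b : (quasiSplit F E c 2).Adelic),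
            conj_mem_adelicUnipotent b.2 w.2⟩ : adelicUnipotent F E c 2)) '' W ⊆ W' := by
  obtain ⟨W₁, hW₁, hW₁mem⟩ := exists_isCompact_torusConj_mem_two (F := F) (E := E) (c := c) hW hR₁
  set W₂ : Set (quasiSplit F E c 2).Adelic :=
    (fun p : (quasiSplit F E c 2).Adelic × (quasiSplit F E c 2).Adelic => p.1⁻¹ * p.2 * p.1) ''
      (Ω ×ˢ ((fun m : adelicUnipotent F E c 2 => (m : (quasiSplit F E c 2).Adelic)) '' W₁)) with hW₂
  have hW₂c : IsCompact W₂ :=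
    (hΩ.prod (hW₁.image continuous_subtype_val)).image
      ((continuous_fst.inv.mul continuous_snd).mul continuous_fst)
  refine ⟨(fun m : adelicUnipotent F E c 2 => (m : (quasiSplit F E c 2).Adelic)) ⁻¹' W₂,
    isCompact_preimage_coe_adelicUnipotent₂ hW₂c, fun b hΩb h₁ => ?_⟩
  rintro _ ⟨w, hw, rfl⟩
  have ht : (((torusPart b : borelAdelic F E c 2)) : (quasiSplit F E c 2).Adelic) ∈ torusAdelic F E c 2 :=
    torusPart_mem_torusAdelic b
  have hd : glDiagonal 2 (AdeleRing (𝓞 E) E) (diagUnit b.2) =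
      adelicVal F E c 2 _ (((torusPart b : borelAdelic F E c 2)) : (quasiSplit F E c 2).Adelic) :=
    (adelicVal_torusPart b).symm
  have hmem := hW₁mem _ ht (diagUnit b.2) hd h₁ w hw
  refine ⟨((((torusPart b)⁻¹ * b : borelAdelic F E c 2) : (quasiSplit F E c 2).Adelic), _),
    Set.mk_mem_prod hΩb (Set.mem_image_of_mem _ hmem), ?_⟩
  change ((((torusPart b)⁻¹ * b : borelAdelic F E c 2) : (quasiSplit F E c 2).Adelic))⁻¹ *
      ((((torusPart b : borelAdelic F E c 2)) : (quasiSplit F E c 2).Adelic)⁻¹ *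
        (w : (quasiSplit F E c 2).Adelic) * (((torusPart b : borelAdelic F E c 2)) : (quasiSplit F E c 2).Adelic)) *
      ((((torusPart b)⁻¹ * b : borelAdelic F E c 2) : (quasiSplit F E c 2).Adelic)) =
    (b : (quasiSplit F E c 2).Adelic)⁻¹ * (w : (quasiSplit F E c 2).Adelic) * (b : (quasiSplit F E c 2).Adelic)
  rw [Subgroup.coe_mul, Subgroup.coe_inv]
  group

/-! ## §4 The `O(δ_B)` count on the Siegel set of `U(J₂)` -/

section Count

variable [LocallyCompactSpace (AdeleRing (𝓞 E) E)] [MeasurableSpace (AdeleRing (𝓞 E) E)] [BorelSpace (AdeleRing (𝓞 E) E)]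
  [MeasurableSpace (adelicUnipotent F E c 2)] [BorelSpace (adelicUnipotent F E c 2)]

/-- **BRICK H4-d AT `N = 2` — ON A SIEGEL SET THE NUMBER OF RATIONAL BOREL ELEMENTS MEETING A COMPACT SET IS `O(δ_B)`.** Let `ν` be a Haar
measure on `N(𝔸_F) ≤ U(J₂)`, `𝓕` a fundamental domain for `N(F)` inside a compact `W₀`, `U ⊆ N(𝔸_F)` compact, `C, K, Ω ⊆ G(𝔸_F)` and
`R₁ ⊆ 𝔸_E` compact. There is `C₀` such that for every `b ∈ B(𝔸_F)` with unipotent part `(torusPart b)⁻¹ b ∈ Ω` and root value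
`d₀⁻¹ d₁ ∈ R₁`, every `k ∈ K` and every finite `R ⊆ B(F)` whose elements `β` have `(b k)⁻¹ β (y · b k) ∈ C` for some `y ∈ U`:
`#R · ν(𝓕) ≤ C₀ · δ_B(b)`, `δ_B(b) = torusRootModulus E 2 (diagUnit b) = ‖b₀₀‖_{𝔸_E}` (★ `card_mul_measure_le_tsum_measure` + §2 + §3 + ★
`finite_setOf_rationalTorus_conj_mem_of_isCompact`). [cite: Rogawski1990, §2.2 (p. 13)] [cite: Arthur1978TraceFormulaI, §5] -/
theorem exists_forall_card_mul_measure_le_mul_torusRootModulus_two (hc : c * c = 1) (hc1 : c ≠ 1)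
    (ν : Measure (adelicUnipotent F E c 2)) [ν.IsHaarMeasure]
    {𝓕 : Set (adelicUnipotent F E c 2)} (h𝓕 : IsFundamentalDomain (rationalUnipotent F E c 2) 𝓕 ν)
    {W₀ : Set (adelicUnipotent F E c 2)} (hW₀ : IsCompact W₀) (h𝓕W₀ : 𝓕 ⊆ W₀)
    {U : Set (adelicUnipotent F E c 2)} (hU : IsCompact U)
    {C : Set (quasiSplit F E c 2).Adelic} (hC : IsCompact C)
    {K : Set (quasiSplit F E c 2).Adelic} (hK : IsCompact K)
    {Ω : Set (quasiSplit F E c 2).Adelic} (hΩ : IsCompact Ω)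
    {R₁ : Set (AdeleRing (𝓞 E) E)} (hR₁ : IsCompact R₁) :
    ∃ C₀ : ℝ≥0, ∀ b : borelAdelic F E c 2,
      (((torusPart b)⁻¹ * b : borelAdelic F E c 2) : (quasiSplit F E c 2).Adelic) ∈ Ω →
      (((diagUnit b.2 0)⁻¹ * diagUnit b.2 1 : (AdeleRing (𝓞 E) E)ˣ) : AdeleRing (𝓞 E) E) ∈ R₁ →
      ∀ k ∈ K, ∀ R : Finset (arithmeticBorel F E c 2),
        (∀ β ∈ R, ∃ y ∈ U, ((b : (quasiSplit F E c 2).Adelic) * k)⁻¹ *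
          (((β : (quasiSplit F E c 2).arithmeticSubgroup)) : (quasiSplit F E c 2).Adelic) *
          ((y : (quasiSplit F E c 2).Adelic) * ((b : (quasiSplit F E c 2).Adelic) * k)) ∈ C) →
        (R.card : ℝ≥0∞) * ν 𝓕 ≤ (C₀ : ℝ≥0∞) * ((torusRootModulus E 2 (diagUnit b.2) : ℝ≥0) : ℝ≥0∞) := by
  classical
  -- `W := U⁻¹ 𝓕 ⊆ Wc := U⁻¹ W₀` compact
  set Wc : Set (adelicUnipotent F E c 2) :=
    (fun p : adelicUnipotent F E c 2 × adelicUnipotent F E c 2 => p.1⁻¹ * p.2) '' (U ×ˢ W₀) with hWc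
  have hWcc : IsCompact Wc := (hU.prod hW₀).image (continuous_fst.inv.mul continuous_snd)
  have hWsub : U⁻¹ * 𝓕 ⊆ Wc := by
    rintro _ ⟨v, hv, m, hm, rfl⟩
    exact ⟨(v⁻¹, m), Set.mk_mem_prod (Set.mem_inv.1 hv) (h𝓕W₀ hm), by simp⟩
  -- `b⁻¹ Wc b ⊆ W'` compact (§3)
  obtain ⟨W', hW'c, hW'⟩ := exists_isCompact_borelConj_image_subset_two (F := F) (E := E) (c := c) hWcc hΩ hR₁
  -- the finite set `S` of torus fibres meeting `K C K⁻¹`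
  have hSfin := finite_setOf_rationalTorus_conj_mem_of_isCompact (N := 2) hC hK hK
  set S : Finset (rationalTorus F E c 2) := hSfin.toFinset with hS
  -- compact cells `B_t = N(𝔸_F) ∩ t⁻¹ K C K⁻¹ ⊇ A_t(k)` for all `k ∈ K`
  set Bt : rationalTorus F E c 2 → Set (adelicUnipotent F E c 2) := fun t =>
    (fun m : adelicUnipotent F E c 2 => (m : (quasiSplit F E c 2).Adelic)) ⁻¹'
      ((fun p : (quasiSplit F E c 2).Adelic × (quasiSplit F E c 2).Adelic =>
        (((t : torusAdelic F E c 2) : (quasiSplit F E c 2).Adelic))⁻¹ * (p.1 * p.2 * p.1⁻¹)) '' (K ×ˢ C))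
    with hBt
  have hBtc : ∀ t, IsCompact (Bt t) := fun t =>
    isCompact_preimage_coe_adelicUnipotent₂
      ((hK.prod hC).image (continuous_const.mul ((continuous_fst.mul continuous_snd).mul continuous_fst.inv)))
  have hfin : ∀ t, ν (Bt t * W') ≠ ∞ := fun t => by
    rw [← Set.image_mul_prod]
    exact (((hBtc t).prod hW'c).image continuous_mul).measure_lt_top.ne
  refine ⟨(∑ t ∈ S, ν (Bt t * W')).toNNReal, fun b hΩb h₁ k hk R hR => ?_⟩
  have hC₀ : (((∑ t ∈ S, ν (Bt t * W')).toNNReal : ℝ≥0) : ℝ≥0∞) = ∑ t ∈ S, ν (Bt t * W') :=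
    ENNReal.coe_toNNReal (ENNReal.sum_ne_top.2 fun t _ => hfin t)
  rw [hC₀]
  -- the conjugation `α = (w ↦ b⁻¹ w b)` and the cells `A_t(k)`
  set α : adelicUnipotent F E c 2 → adelicUnipotent F E c 2 := fun w =>
    ⟨(b : (quasiSplit F E c 2).Adelic)⁻¹ * (w : (quasiSplit F E c 2).Adelic) * (b : (quasiSplit F E c 2).Adelic),
      conj_mem_adelicUnipotent b.2 w.2⟩ with hα
  have hαW : α '' (U⁻¹ * 𝓕) ⊆ W' := (Set.image_mono hWsub).trans (hW' b hΩb h₁)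
  set A : rationalTorus F E c 2 → Set (adelicUnipotent F E c 2) := fun t =>
    {m : adelicUnipotent F E c 2 | k⁻¹ * ((t : torusAdelic F E c 2) : (quasiSplit F E c 2).Adelic) *
      ((m : adelicUnipotent F E c 2) : (quasiSplit F E c 2).Adelic) * k ∈ C} with hA
  have hAB : ∀ t, A t ⊆ Bt t := by
    intro t m hm
    refine ⟨(k, k⁻¹ * ((t : torusAdelic F E c 2) : (quasiSplit F E c 2).Adelic) *
      ((m : adelicUnipotent F E c 2) : (quasiSplit F E c 2).Adelic) * k), Set.mk_mem_prod hk hm, ?_⟩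
    change (((t : torusAdelic F E c 2) : (quasiSplit F E c 2).Adelic))⁻¹ *
        (k * (k⁻¹ * ((t : torusAdelic F E c 2) : (quasiSplit F E c 2).Adelic) *
          ((m : adelicUnipotent F E c 2) : (quasiSplit F E c 2).Adelic) * k) * k⁻¹) =
      ((m : adelicUnipotent F E c 2) : (quasiSplit F E c 2).Adelic)
    group
  have hA0 : ∀ t ∉ S, A t = ∅ := by
    intro t ht
    refine Set.eq_empty_iff_forall_notMem.2 fun m hm => ht ?_
    rw [hS, Set.Finite.mem_toFinset]
    exact ⟨k, hk, k, hk, m, hm⟩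
  have hterm : ∀ t, ν (A t * α '' (U⁻¹ * 𝓕)) ≤ ν (Bt t * W') := fun t =>
    measure_mono (Set.mul_subset_mul (hAB t) hαW)
  calc (R.card : ℝ≥0∞) * ν 𝓕
      ≤ ∑' t : rationalTorus F E c 2,
          ν ({m : adelicUnipotent F E c 2 | ((b : (quasiSplit F E c 2).Adelic) * k)⁻¹ *
              ((t : torusAdelic F E c 2) : (quasiSplit F E c 2).Adelic) *
              ((m : adelicUnipotent F E c 2) : (quasiSplit F E c 2).Adelic) *
              ((b : (quasiSplit F E c 2).Adelic) * k) ∈ C} * (U⁻¹ * 𝓕)) :=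
        card_mul_measure_le_tsum_measure ν h𝓕 ((b : (quasiSplit F E c 2).Adelic) * k) C U R hR
    _ ≤ ∑' t : rationalTorus F E c 2,
          ((torusRootModulus E 2 (diagUnit b.2) : ℝ≥0) : ℝ≥0∞) * ν (A t * α '' (U⁻¹ * 𝓕)) :=
        ENNReal.tsum_le_tsum fun t => measure_cellSet_borel_mul_le_two hc hc1 ν b k C (U⁻¹ * 𝓕) t
    _ = ((torusRootModulus E 2 (diagUnit b.2) : ℝ≥0) : ℝ≥0∞) *
          ∑' t : rationalTorus F E c 2, ν (A t * α '' (U⁻¹ * 𝓕)) :=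
        ENNReal.tsum_mul_left
    _ = ((torusRootModulus E 2 (diagUnit b.2) : ℝ≥0) : ℝ≥0∞) *
          ∑ t ∈ S, ν (A t * α '' (U⁻¹ * 𝓕)) := by
        rw [tsum_eq_sum (s := S) fun t ht => by rw [hA0 t ht, Set.empty_mul, measure_empty]]
    _ ≤ ((torusRootModulus E 2 (diagUnit b.2) : ℝ≥0) : ℝ≥0∞) * ∑ t ∈ S, ν (Bt t * W') :=
        mul_le_mul' le_rfl (Finset.sum_le_sum fun t _ => hterm t)
    _ = (∑ t ∈ S, ν (Bt t * W')) * ((torusRootModulus E 2 (diagUnit b.2) : ℝ≥0) : ℝ≥0∞) :=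
        mul_comm _ _

end Count

end UnitaryGroup

end Literature.NumberTheory.Automorphic

end
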